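import Literature.Topology.FourManifolds.SurfaceGroupHomologyMoveBlocks
import HarnessLib

/-!
# Helper I for stub `stub_goeritzRealisationThree` (line `nilpotent-genus-class`, crux
`CongruenceShadows.ShadowApproximation`, item stmt-SmoothPoincare4-14595): Goeritz realisers at genus 3

Setting. `S₃ = SurfaceGroup 3 = ⟨a₀,b₀,a₁,b₁,a₂,b₂ ∣ [a₀,b₀][a₁,b₁][a₂,b₂]⟩`, the standard kernels
`N₀ = s4Kernels 0 = ⟪a₀,a₁,b₂⟫`, `N₁ = s4Kernels 1 = ⟪a₀,b₁,a₂⟫` (the genus-`3` Heegaard splitting of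
`S¹ × S²` sitting inside the genus-`3` trisection of `S⁴`), `H₁ = (surfaceGen 3 → ℤ)` with the
intersection form `symplForm` and the Hurewicz map `SurfaceGroup.abelianize 3`.  The **Goeritz group**
is `Stab N₀ ∩ Stab N₁ ≤ Aut S₃`.  This file and its sequel exhibit, for each generator of the integral
pair-stabiliser `Stab_{Sp^±(6,ℤ)}(Λ₀, Λ₁)` (`Λ₀ = ⟨a₀,a₁,b₂⟩`, `Λ₁ = ⟨a₀,b₁,a₂⟩`), an explicit Goeritz
element inducing it on `H₁`.

Tools (all elementary):
* `mk_mem_s4Kernels_iff` — **membership in `Nᵢ` by erasure**: the class of a word `w` lies in `Nᵢ`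
  iff deleting the letters of the cut system `s4Gens i` from `w` gives the trivial word of the free
  group on the three survivors (`quotientEquivFreeGroupErase`: `S₃ ⧸ Nᵢ ≅ F₃`); decidable.
* `map_s4Kernels_eq_of_free` — an automorphism given with free-group lifts of itself and of its
  inverse stabilises `Nᵢ` as soon as the (inverse) images of the three cut letters erase to `1`
  (decidable); `realises_of_free` — it induces the linear map `f` on `H₁` as soon as the exponent-sum
  vectors of the six generator images are the `f δ_x` (decidable).
* the linear maps needed to NAME homology actions that are not among the library's `moveX/Y/Z/W`:
  `moveE c` (`a₁ ↦ a₁ + c b₂`, `a₂ ↦ a₂ + c b₁`, the lower unipotent of the `GL₂` Levi block) and the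
  sign changes `negCoords P` (`negHandle k`: `a_k, b_k ↦ -a_k, -b_k`; `negB`: `bᵢ ↦ -bᵢ`).

Realisers in this file (each a `RelatorAut 3`: free-group generator images and inverse images FIXING
THE RELATOR ON THE NOSE, all identities by `decide`; so they can be block-summed, `RelatorAut.blockSum`):
* `w01` (the handle slide `σ₀₁` of `Negative/Slides.lean` composed with `Inn(a₁⁻¹)`): `moveW 0 1 1`
  (`b₀ ↦ b₀ + a₁`, `b₁ ↦ b₁ + a₀`); `w12`: `moveW 1 2 1`; `w02`: `moveW 0 2 1`;
* `e12` (the cut-swap conjugate `J₁₂⁻¹ σ₁₂⁻¹ J₁₂` of the slide `σ₁₂`): `moveE 1`;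
* `z01` (a handle slide of type (C), Zieschang–Vogt–Coldewey 3.6.9 (C), conjugated into the
  Goeritz group): `moveZ 0 1 1` (`a₁ ↦ a₁ + a₀`, `b₀ ↦ b₀ - b₁`).
Each comes with `⋯_goeritz : σ(N₀) = N₀ ∧ σ(N₁) = N₁ ∧ (σ induces the move on H₁)`.  The words were found and
checked with a free-group calculator (seat folder `work/stubs/py/`); Lean rechecks everything by
`decide`.  Sequel: `…StubGoeritzThreeRealisersTwo.lean` (`z02`, the twist `x0`, the handle signs
`eps k`, the reflection `iota`).

## References

* H. Zieschang, E. Vogt, H.-D. Coldewey, *Surfaces and Planar Discontinuous Groups*, LNM 835,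
  Springer (1980), §3.6, 3.6.9 (A)–(C). [ZieschangVogtColdewey1980]
* D. Gay, R. Kirby, *Trisecting 4-manifolds*, Geom. Topol. 20 (2016), §1–2. [GayKirby2016]
-/

-- the prescribed namespace `Summit.<P>.<Sub>.…` duplicates `SmoothPoincare4` (P = Sub)
set_option linter.dupNamespace false
noncomputable section
open Literature.Topology.FourManifolds Multiplicative

namespace Summit.SmoothPoincare4.SmoothPoincare4.Theorems.ShadowApproximation.NilpotentGenusClass

/-! ## Tools: kernel membership by erasure, homology by exponent sums -/

/-- **Membership in `Nᵢ` by erasure.** The class of the word `w` lies in `Nᵢ = ⟪letters of s4Gens i⟫`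
iff erasing those letters from `w` gives `1` in the free group on the survivors
(`S₃ ⧸ Nᵢ ≅ F⟨survivors⟩`, `quotientEquivFreeGroupErase`). [folklore] -/
theorem mk_mem_s4Kernels_iff (i : Fin 3) (w : FreeGroup (surfaceGen 3)) :
    (PresentedGroup.mk _ w : SurfaceGroup 3) ∈ s4Kernels i ↔
      FreeGroup.lift (eraseGen (s4Gens i)) w = 1 := by
  haveI : (s4Kernels i).Normal := by rw [s4Kernels_eq]; infer_instance
  constructor
  · intro h
    exact s4Kernels_le_ker (s4Gens i) (s4Gens_hits i) i le_rfl h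
  · intro h
    let e := quotientEquivFreeGroupErase (s4Gens i) (s4Gens_hits i) (s4Kernels i)
      (fun x hx => of_mem_s4Kernels i hx) (s4Kernels_le_ker _ _ i le_rfl)
    have h1 : e (QuotientGroup.mk (PresentedGroup.mk _ w)) = 1 := h
    rwa [map_eq_one_iff _ e.injective, QuotientGroup.eq_one_iff] at h1

/-- **Kernel criterion.** An automorphism `σ` of `S₃` with free lifts `F` of `σ` and `G` of `σ⁻¹` on
generators stabilises `Nᵢ` if the `F`- and `G`-images of the three cut letters erase to `1`
(`Nᵢ` is the normal closure of its cut letters). [folklore] -/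
theorem map_s4Kernels_eq_of_free (σ : SurfaceGroup 3 ≃* SurfaceGroup 3)
    (F G : FreeGroup (surfaceGen 3) →* FreeGroup (surfaceGen 3))
    (hF : ∀ x, σ (PresentedGroup.of x) = PresentedGroup.mk _ (F (FreeGroup.of x)))
    (hG : ∀ x, σ.symm (PresentedGroup.of x) = PresentedGroup.mk _ (G (FreeGroup.of x))) (i : Fin 3)
    (h : ∀ p ∈ s4Gens i, FreeGroup.lift (eraseGen (s4Gens i)) (F (FreeGroup.of p)) = 1)
    (h' : ∀ p ∈ s4Gens i, FreeGroup.lift (eraseGen (s4Gens i)) (G (FreeGroup.of p)) = 1) :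
    (s4Kernels i).map σ.toMonoidHom = s4Kernels i := by
  rw [s4Kernels_eq]
  refine RelatorAut.map_normalClosure_eq_of _ _ _ ?_ ?_
  · rintro _ ⟨p, hp, rfl⟩
    rw [← s4Kernels_eq, hF, mk_mem_s4Kernels_iff]
    exact h p hp
  · rintro _ ⟨p, hp, rfl⟩
    rw [← s4Kernels_eq, hG, mk_mem_s4Kernels_iff]
    exact h' p hp

/-- **Homology criterion.** If `σ` has the free lift `F` on generators and the exponent-sum vector of
`F x` is `f δ_x` for every letter `x`, then `σ` induces `f` on `H₁`. [folklore] -/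
theorem realises_of_free (σ : SurfaceGroup 3 ≃* SurfaceGroup 3)
    (F : FreeGroup (surfaceGen 3) →* FreeGroup (surfaceGen 3))
    (hF : ∀ x, σ (PresentedGroup.of x) = PresentedGroup.mk _ (F (FreeGroup.of x)))
    (f : (surfaceGen 3 → ℤ) ≃ₗ[ℤ] (surfaceGen 3 → ℤ))
    (h : ∀ x, toAdd (FreeGroup.lift (fun y : surfaceGen 3 => ofAdd (Pi.single y (1 : ℤ)))
      (F (FreeGroup.of x))) = f (Pi.single x 1)) :
    ∀ s, toAdd (SurfaceGroup.abelianize 3 (σ s)) = f (toAdd (SurfaceGroup.abelianize 3 s)) := by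
  refine abelianize_comp_eq_of_apply_of _ _ fun x => ?_
  rw [hF, SurfaceGroup.abelianize_mk]
  exact h x

/-- `A.toMulEquiv` has the free lift `A.hom`. [folklore] -/
theorem relatorAut_of (A : RelatorAut 3) (x : surfaceGen 3) :
    A.toMulEquiv (PresentedGroup.of x) = PresentedGroup.mk _ (A.hom (FreeGroup.of x)) :=
  A.toMulEquiv_mk (FreeGroup.of x)

/-- `A.toMulEquiv⁻¹` has the free lift `A.inv`. [folklore] -/
theorem relatorAut_symm_of (A : RelatorAut 3) (x : surfaceGen 3) :
    A.toMulEquiv.symm (PresentedGroup.of x) = PresentedGroup.mk _ (A.inv (FreeGroup.of x)) :=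
  A.toMulEquiv_symm_mk (FreeGroup.of x)

/-- `Goeritz⟪σ, f⟫`: `σ` stabilises `N₀` and `N₁` (it is a Goeritz element) and induces `f` on `H₁`
(file-local notation; the three conjuncts are what the stub consumes). -/
local notation3 "Goeritz⟪" σ ", " f "⟫" =>
  Subgroup.map (MulEquiv.toMonoidHom (σ : SurfaceGroup 3 ≃* SurfaceGroup 3)) (s4Kernels 0) =
      s4Kernels 0 ∧
    Subgroup.map (MulEquiv.toMonoidHom (σ : SurfaceGroup 3 ≃* SurfaceGroup 3)) (s4Kernels 1) =
      s4Kernels 1 ∧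
    ∀ s : SurfaceGroup 3, toAdd (SurfaceGroup.abelianize 3 ((σ : SurfaceGroup 3 ≃* SurfaceGroup 3) s)) =
      (f : (surfaceGen 3 → ℤ) ≃ₗ[ℤ] (surfaceGen 3 → ℤ)) (toAdd (SurfaceGroup.abelianize 3 s))

/-- Decidable sufficient condition for `IsGoeritzRealiser A.toMulEquiv f`, `A : RelatorAut 3`: the
erasure tests for `N₀, N₁` on the images and inverse images of the cut letters, and the exponent-sum
test on the six generator images. [folklore] -/
theorem goeritz_of_decide (A : RelatorAut 3) (f : (surfaceGen 3 → ℤ) ≃ₗ[ℤ] (surfaceGen 3 → ℤ))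
    (h0 : ∀ p ∈ s4Gens 0, FreeGroup.lift (eraseGen (s4Gens 0)) (A.hom (FreeGroup.of p)) = 1)
    (h0' : ∀ p ∈ s4Gens 0, FreeGroup.lift (eraseGen (s4Gens 0)) (A.inv (FreeGroup.of p)) = 1)
    (h1 : ∀ p ∈ s4Gens 1, FreeGroup.lift (eraseGen (s4Gens 1)) (A.hom (FreeGroup.of p)) = 1)
    (h1' : ∀ p ∈ s4Gens 1, FreeGroup.lift (eraseGen (s4Gens 1)) (A.inv (FreeGroup.of p)) = 1)
    (h : ∀ x, toAdd (FreeGroup.lift (fun y : surfaceGen 3 => ofAdd (Pi.single y (1 : ℤ)))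
      (A.hom (FreeGroup.of x))) = f (Pi.single x 1)) :
    Goeritz⟪A.toMulEquiv, f⟫ :=
  ⟨map_s4Kernels_eq_of_free _ A.hom A.inv (relatorAut_of A) (relatorAut_symm_of A) 0 h0 h0',
    map_s4Kernels_eq_of_free _ A.hom A.inv (relatorAut_of A) (relatorAut_symm_of A) 1 h1 h1',
    realises_of_free _ A.hom (relatorAut_of A) f h⟩

/-! ## Two more linear maps on `H₁`: the lower unipotent `moveE` and the sign changes -/

/-- The nilpotent part of `moveE`: `v ↦ v(a₁) δ_{b₂} + v(a₂) δ_{b₁}`. [folklore] -/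
def nilE : (surfaceGen 3 → ℤ) →ₗ[ℤ] (surfaceGen 3 → ℤ) :=
  coordMap ((1 : Fin 3), false) ((2 : Fin 3), true) + coordMap ((2 : Fin 3), false) ((1 : Fin 3), true)

/-- `nilE` unfolded. [folklore] -/
@[simp] theorem nilE_apply (v : surfaceGen 3 → ℤ) : nilE v =
    Pi.single ((2 : Fin 3), true) (v ((1 : Fin 3), false)) +
      Pi.single ((1 : Fin 3), true) (v ((2 : Fin 3), false)) := rfl

/-- `nilE` is square-zero (it reads `a`-coordinates and writes `b`-coordinates). [folklore] -/
theorem nilE_nilE (v : surfaceGen 3 → ℤ) : nilE (nilE v) = 0 := by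
  ext x
  simp

/-- **`moveE c`**: the linear automorphism `a₁ ↦ a₁ + c b₂`, `a₂ ↦ a₂ + c b₁` of `H₁` (identity on the
other basis vectors) — together with `moveW 1 2 c` (`b₂ ↦ b₂ + c a₁`, `b₁ ↦ b₁ + c a₂`) it generates
the `SL₂(ℤ)` of the Levi block of the pair-stabiliser acting on `Λ₀/ℤa₀ = ⟨a₁, b₂⟩`. [folklore] -/
def moveE (c : ℤ) : (surfaceGen 3 → ℤ) ≃ₗ[ℤ] (surfaceGen 3 → ℤ) := shear nilE nilE_nilE c

/-- `moveE` on coordinates. [folklore] -/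
theorem moveE_apply (c : ℤ) (v : surfaceGen 3 → ℤ) : moveE c v =
    v + c • (Pi.single ((2 : Fin 3), true) (v ((1 : Fin 3), false)) +
      Pi.single ((1 : Fin 3), true) (v ((2 : Fin 3), false))) := rfl

/-- **Sign change** of the coordinates in a decidable set `P` of letters (an involutive linear
automorphism of `H₁`). [folklore] -/
def negCoords (P : surfaceGen 3 → Prop) [DecidablePred P] :
    (surfaceGen 3 → ℤ) ≃ₗ[ℤ] (surfaceGen 3 → ℤ) where
  toFun v x := if P x then -v x else v x
  invFun v x := if P x then -v x else v x
  map_add' v w := by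
    funext x
    simp only [Pi.add_apply]
    split_ifs <;> ring
  map_smul' c v := by
    funext x
    simp only [Pi.smul_apply, smul_eq_mul, RingHom.id_apply]
    split_ifs <;> ring
  left_inv v := by
    funext x
    dsimp only
    split_ifs <;> ring
  right_inv v := by
    funext x
    dsimp only
    split_ifs <;> ring

/-- `negCoords` on coordinates. [folklore] -/
@[simp] theorem negCoords_apply (P : surfaceGen 3 → Prop) [DecidablePred P] (v : surfaceGen 3 → ℤ)
    (x : surfaceGen 3) : negCoords P v x = if P x then -v x else v x := rfl

/-- **`negHandle k`**: `a_k ↦ -a_k`, `b_k ↦ -b_k`, the other basis vectors fixed. [folklore] -/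
def negHandle (k : Fin 3) : (surfaceGen 3 → ℤ) ≃ₗ[ℤ] (surfaceGen 3 → ℤ) :=
  negCoords (fun x : surfaceGen 3 => x.1 = k)

/-- `negHandle` on coordinates. [folklore] -/
@[simp] theorem negHandle_apply (k : Fin 3) (v : surfaceGen 3 → ℤ) (x : surfaceGen 3) :
    negHandle k v x = if x.1 = k then -v x else v x := rfl

/-- **`negB`**: `aᵢ ↦ aᵢ`, `bᵢ ↦ -bᵢ` (the homology action of a reflection of `Σ₃`; it negates the
intersection form). [folklore] -/
def negB : (surfaceGen 3 → ℤ) ≃ₗ[ℤ] (surfaceGen 3 → ℤ) :=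
  negCoords (fun x : surfaceGen 3 => x.2 = true)

/-- `negB` on coordinates. [folklore] -/
@[simp] theorem negB_apply (v : surfaceGen 3 → ℤ) (x : surfaceGen 3) :
    negB v x = if x.2 = true then -v x else v x := rfl

/-! ## The realisers -/
/-- Generator images of `w01`: `a0 ↦ A1 a0 a1`, `b0 ↦ A1 A0 a1 a0 b0 a1`, `a1 ↦ A1 A0 a1 a0 a1`, `b1 ↦ b1 A1 a0 a1`. [folklore] -/
def w01Fun (x : surfaceGen 3) : FreeGroup (surfaceGen 3) :=
  if x = ((0 : Fin 3), false) then
    (genA 1)⁻¹ * genA 0 * genA 1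
  else if x = ((0 : Fin 3), true) then
    (genA 1)⁻¹ * (genA 0)⁻¹ * genA 1 * genA 0 * genB 0 * genA 1
  else if x = ((1 : Fin 3), false) then
    (genA 1)⁻¹ * (genA 0)⁻¹ * genA 1 * genA 0 * genA 1
  else if x = ((1 : Fin 3), true) then
    genB 1 * (genA 1)⁻¹ * genA 0 * genA 1
  else FreeGroup.of x

/-- Generator images of `w01⁻¹`: `a0 ↦ a0 a1 a0 A1 A0`, `b0 ↦ a0 a1 A0 A1 b0 a0 A1 A0`, `a1 ↦ a0 a1 A0`, `b1 ↦ b1 A0`. [folklore] -/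
def w01Inv (x : surfaceGen 3) : FreeGroup (surfaceGen 3) :=
  if x = ((0 : Fin 3), false) then
    genA 0 * genA 1 * genA 0 * (genA 1)⁻¹ * (genA 0)⁻¹
  else if x = ((0 : Fin 3), true) then
    genA 0 * genA 1 * (genA 0)⁻¹ * (genA 1)⁻¹ * genB 0 * genA 0 * (genA 1)⁻¹ * (genA 0)⁻¹
  else if x = ((1 : Fin 3), false) then
    genA 0 * genA 1 * (genA 0)⁻¹
  else if x = ((1 : Fin 3), true) then
    genB 1 * (genA 0)⁻¹
  else FreeGroup.of x

/-- **The slide `σ₀₁`** (`Negative/Slides.lean`) normalised by `Inn(a₁⁻¹)`, as a relator-fixing automorphism of `S₃` (all four free-group identities by `decide`).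
[folklore] -/
def w01 : RelatorAut 3 :=
  RelatorAut.ofGens w01Fun w01Inv (by decide) (by decide) (by decide) (by decide)

/-- **`w01` is a Goeritz element realising `moveW 0 1 1` (`b₀ ↦ b₀ + a₁`, `b₁ ↦ b₁ + a₀`)`** (kernels by erasure, homology by exponent
sums, both by `decide`). [folklore] -/
theorem w01_goeritz : Goeritz⟪w01.toMulEquiv, moveW 0 1 1⟫ :=
  goeritz_of_decide w01 _ (by decide) (by decide) (by decide) (by decide) (by decide)
/-- Generator images of `w12`: `a1 ↦ A2 a1 a2`, `b1 ↦ A2 A1 a2 a1 b1 a2`, `a2 ↦ A2 A1 a2 a1 a2`, `b2 ↦ b2 A2 a1 a2`. [folklore] -/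
def w12Fun (x : surfaceGen 3) : FreeGroup (surfaceGen 3) :=
  if x = ((1 : Fin 3), false) then
    (genA 2)⁻¹ * genA 1 * genA 2
  else if x = ((1 : Fin 3), true) then
    (genA 2)⁻¹ * (genA 1)⁻¹ * genA 2 * genA 1 * genB 1 * genA 2
  else if x = ((2 : Fin 3), false) then
    (genA 2)⁻¹ * (genA 1)⁻¹ * genA 2 * genA 1 * genA 2
  else if x = ((2 : Fin 3), true) then
    genB 2 * (genA 2)⁻¹ * genA 1 * genA 2
  else FreeGroup.of x

/-- Generator images of `w12⁻¹`: `a1 ↦ a1 a2 a1 A2 A1`, `b1 ↦ a1 a2 A1 A2 b1 a1 A2 A1`, `a2 ↦ a1 a2 A1`, `b2 ↦ b2 A1`. [folklore] -/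
def w12Inv (x : surfaceGen 3) : FreeGroup (surfaceGen 3) :=
  if x = ((1 : Fin 3), false) then
    genA 1 * genA 2 * genA 1 * (genA 2)⁻¹ * (genA 1)⁻¹
  else if x = ((1 : Fin 3), true) then
    genA 1 * genA 2 * (genA 1)⁻¹ * (genA 2)⁻¹ * genB 1 * genA 1 * (genA 2)⁻¹ * (genA 1)⁻¹
  else if x = ((2 : Fin 3), false) then
    genA 1 * genA 2 * (genA 1)⁻¹
  else if x = ((2 : Fin 3), true) then
    genB 2 * (genA 1)⁻¹
  else FreeGroup.of x

/-- **The slide `σ₁₂`** (index shift of `σ₀₁`), as a relator-fixing automorphism of `S₃` (all four free-group identities by `decide`).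
[folklore] -/
def w12 : RelatorAut 3 :=
  RelatorAut.ofGens w12Fun w12Inv (by decide) (by decide) (by decide) (by decide)

/-- **`w12` is a Goeritz element realising `moveW 1 2 1` (`b₁ ↦ b₁ + a₂`, `b₂ ↦ b₂ + a₁`; the upper unipotent `E'` of the Levi block)`** (kernels by erasure, homology by exponent
sums, both by `decide`). [folklore] -/
theorem w12_goeritz : Goeritz⟪w12.toMulEquiv, moveW 1 2 1⟫ :=
  goeritz_of_decide w12 _ (by decide) (by decide) (by decide) (by decide) (by decide)
/-- Generator images of `w02`: `a0 ↦ A2 a0 a2`, `b0 ↦ A2 A0 a2 a0 b0 a2`, `a1 ↦ A2 A0 a2 a0 a1 A0 A2 a0 a2`, `b1 ↦ A2 A0 a2 a0 b1 A0 A2 a0 a2`, `a2 ↦ A2 A0 a2 a0 a2`, `b2 ↦ b2 A2 a0 a2`. [folklore] -/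
def w02Fun (x : surfaceGen 3) : FreeGroup (surfaceGen 3) :=
  if x = ((0 : Fin 3), false) then
    (genA 2)⁻¹ * genA 0 * genA 2
  else if x = ((0 : Fin 3), true) then
    (genA 2)⁻¹ * (genA 0)⁻¹ * genA 2 * genA 0 * genB 0 * genA 2
  else if x = ((1 : Fin 3), false) then
    (genA 2)⁻¹ * (genA 0)⁻¹ * genA 2 * genA 0 * genA 1 * (genA 0)⁻¹ * (genA 2)⁻¹ * genA 0 * genA 2
  else if x = ((1 : Fin 3), true) then
    (genA 2)⁻¹ * (genA 0)⁻¹ * genA 2 * genA 0 * genB 1 * (genA 0)⁻¹ * (genA 2)⁻¹ * genA 0 * genA 2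
  else if x = ((2 : Fin 3), false) then
    (genA 2)⁻¹ * (genA 0)⁻¹ * genA 2 * genA 0 * genA 2
  else if x = ((2 : Fin 3), true) then
    genB 2 * (genA 2)⁻¹ * genA 0 * genA 2
  else FreeGroup.of x

/-- Generator images of `w02⁻¹`: `a0 ↦ a0 a2 a0 A2 A0`, `b0 ↦ a0 a2 A0 A2 b0 a0 A2 A0`, `a1 ↦ a0 a2 A0 A2 a1 a2 a0 A2 A0`, `b1 ↦ a0 a2 A0 A2 b1 a2 a0 A2 A0`, `a2 ↦ a0 a2 A0`, `b2 ↦ b2 A0`. [folklore] -/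
def w02Inv (x : surfaceGen 3) : FreeGroup (surfaceGen 3) :=
  if x = ((0 : Fin 3), false) then
    genA 0 * genA 2 * genA 0 * (genA 2)⁻¹ * (genA 0)⁻¹
  else if x = ((0 : Fin 3), true) then
    genA 0 * genA 2 * (genA 0)⁻¹ * (genA 2)⁻¹ * genB 0 * genA 0 * (genA 2)⁻¹ * (genA 0)⁻¹
  else if x = ((1 : Fin 3), false) then
    genA 0 * genA 2 * (genA 0)⁻¹ * (genA 2)⁻¹ * genA 1 * genA 2 * genA 0 * (genA 2)⁻¹ * (genA 0)⁻¹
  else if x = ((1 : Fin 3), true) then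
    genA 0 * genA 2 * (genA 0)⁻¹ * (genA 2)⁻¹ * genB 1 * genA 2 * genA 0 * (genA 2)⁻¹ * (genA 0)⁻¹
  else if x = ((2 : Fin 3), false) then
    genA 0 * genA 2 * (genA 0)⁻¹
  else if x = ((2 : Fin 3), true) then
    genB 2 * (genA 0)⁻¹
  else FreeGroup.of x

/-- **The slide `σ₀₂`**, as a relator-fixing automorphism of `S₃` (all four free-group identities by `decide`).
[folklore] -/
def w02 : RelatorAut 3 :=
  RelatorAut.ofGens w02Fun w02Inv (by decide) (by decide) (by decide) (by decide)

/-- **`w02` is a Goeritz element realising `moveW 0 2 1` (`b₀ ↦ b₀ + a₂`, `b₂ ↦ b₂ + a₀`)`** (kernels by erasure, homology by exponent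
sums, both by `decide`). [folklore] -/
theorem w02_goeritz : Goeritz⟪w02.toMulEquiv, moveW 0 2 1⟫ :=
  goeritz_of_decide w02 _ (by decide) (by decide) (by decide) (by decide) (by decide)
/-- Generator images of `e12`: `a1 ↦ a1 B1 b2 b1`, `b1 ↦ B1 B2 b1 b2 b1`, `a2 ↦ B1 B2 b1 b2 a2 b1`, `b2 ↦ B1 b2 b1`. [folklore] -/
def e12Fun (x : surfaceGen 3) : FreeGroup (surfaceGen 3) :=
  if x = ((1 : Fin 3), false) then
    genA 1 * (genB 1)⁻¹ * genB 2 * genB 1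
  else if x = ((1 : Fin 3), true) then
    (genB 1)⁻¹ * (genB 2)⁻¹ * genB 1 * genB 2 * genB 1
  else if x = ((2 : Fin 3), false) then
    (genB 1)⁻¹ * (genB 2)⁻¹ * genB 1 * genB 2 * genA 2 * genB 1
  else if x = ((2 : Fin 3), true) then
    (genB 1)⁻¹ * genB 2 * genB 1
  else FreeGroup.of x

/-- Generator images of `e12⁻¹`: `a1 ↦ a1 B2`, `b1 ↦ b2 b1 B2`, `a2 ↦ b2 b1 B2 B1 a2 b2 B1 B2`, `b2 ↦ b2 b1 b2 B1 B2`. [folklore] -/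
def e12Inv (x : surfaceGen 3) : FreeGroup (surfaceGen 3) :=
  if x = ((1 : Fin 3), false) then
    genA 1 * (genB 2)⁻¹
  else if x = ((1 : Fin 3), true) then
    genB 2 * genB 1 * (genB 2)⁻¹
  else if x = ((2 : Fin 3), false) then
    genB 2 * genB 1 * (genB 2)⁻¹ * (genB 1)⁻¹ * genA 2 * genB 2 * (genB 1)⁻¹ * (genB 2)⁻¹
  else if x = ((2 : Fin 3), true) then
    genB 2 * genB 1 * genB 2 * (genB 1)⁻¹ * (genB 2)⁻¹
  else FreeGroup.of x

/-- **The lower unipotent `E`**: the conjugate of the slide `σ₁₂⁻¹` by the cut swap `J₁₂` (`aᵢ ↦ aᵢbᵢaᵢ⁻¹`, `bᵢ ↦ aᵢ⁻¹` on handles `1, 2`, which exchanges `N₀` and `N₁`), as a relator-fixing automorphism of `S₃` (all four free-group identities by `decide`).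
[folklore] -/
def e12 : RelatorAut 3 :=
  RelatorAut.ofGens e12Fun e12Inv (by decide) (by decide) (by decide) (by decide)

/-- **`e12` is a Goeritz element realising `moveE 1` (`a₁ ↦ a₁ + b₂`, `a₂ ↦ a₂ + b₁`)`** (kernels by erasure, homology by exponent
sums, both by `decide`). [folklore] -/
theorem e12_goeritz : Goeritz⟪e12.toMulEquiv, moveE 1⟫ :=
  goeritz_of_decide e12 _ (by decide) (by decide) (by decide) (by decide) (by decide)
/-- Generator images of `z01`: `a0 ↦ b1 a0 B1`, `b0 ↦ b1 A0 B1 a0 b0 B1`, `a1 ↦ b1 A0 B1 a0 a1 b1 a0 B1`, `b1 ↦ b1 A0 b1 a0 B1`. [folklore] -/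
def z01Fun (x : surfaceGen 3) : FreeGroup (surfaceGen 3) :=
  if x = ((0 : Fin 3), false) then
    genB 1 * genA 0 * (genB 1)⁻¹
  else if x = ((0 : Fin 3), true) then
    genB 1 * (genA 0)⁻¹ * (genB 1)⁻¹ * genA 0 * genB 0 * (genB 1)⁻¹
  else if x = ((1 : Fin 3), false) then
    genB 1 * (genA 0)⁻¹ * (genB 1)⁻¹ * genA 0 * genA 1 * genB 1 * genA 0 * (genB 1)⁻¹
  else if x = ((1 : Fin 3), true) then
    genB 1 * (genA 0)⁻¹ * genB 1 * genA 0 * (genB 1)⁻¹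
  else FreeGroup.of x

/-- Generator images of `z01⁻¹`: `a0 ↦ a0 B1 a0 b1 A0`, `b0 ↦ a0 B1 A0 b1 b0 a0 b1 A0`, `a1 ↦ a0 B1 A0 b1 a1 A0`, `b1 ↦ a0 b1 A0`. [folklore] -/
def z01Inv (x : surfaceGen 3) : FreeGroup (surfaceGen 3) :=
  if x = ((0 : Fin 3), false) then
    genA 0 * (genB 1)⁻¹ * genA 0 * genB 1 * (genA 0)⁻¹
  else if x = ((0 : Fin 3), true) then
    genA 0 * (genB 1)⁻¹ * (genA 0)⁻¹ * genB 1 * genB 0 * genA 0 * genB 1 * (genA 0)⁻¹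
  else if x = ((1 : Fin 3), false) then
    genA 0 * (genB 1)⁻¹ * (genA 0)⁻¹ * genB 1 * genA 1 * (genA 0)⁻¹
  else if x = ((1 : Fin 3), true) then
    genA 0 * genB 1 * (genA 0)⁻¹
  else FreeGroup.of x

/-- **Type (C) on handles `0, 1`**: the inverse of the handle slide `SurfaceGroup.slideEquiv (0<1)` times the twist `τ_{a₀}`, normalised to fix the relator, as a relator-fixing automorphism of `S₃` (all four free-group identities by `decide`).
[folklore] -/
def z01 : RelatorAut 3 :=
  RelatorAut.ofGens z01Fun z01Inv (by decide) (by decide) (by decide) (by decide)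

/-- **`z01` is a Goeritz element realising `moveZ 0 1 1` (`a₁ ↦ a₁ + a₀`, `b₀ ↦ b₀ - b₁`)`** (kernels by erasure, homology by exponent
sums, both by `decide`). [folklore] -/
theorem z01_goeritz : Goeritz⟪z01.toMulEquiv, moveZ 0 1 (by decide) 1⟫ :=
  goeritz_of_decide z01 _ (by decide) (by decide) (by decide) (by decide) (by decide)

/-! ## Registered sub-goal of this helper file -/

/-- **Registered sub-goal `exists_goeritz_moveW12`** (helper I of stub `stub_goeritzRealisationThree`):
the upper unipotent `E' = moveW 1 2 1` of the Levi block is induced on `H₁` by a Goeritz element of the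
genus-`3` splitting (namely the slide `w12`). [folklore] -/
theorem exists_goeritz_moveW12 : ∃ σ : SurfaceGroup 3 ≃* SurfaceGroup 3, (s4Kernels 0).map σ.toMonoidHom = s4Kernels 0 ∧ (s4Kernels 1).map σ.toMonoidHom = s4Kernels 1 ∧ ∀ s : SurfaceGroup 3, toAdd (SurfaceGroup.abelianize 3 (σ s)) = moveW 1 2 1 (toAdd (SurfaceGroup.abelianize 3 s)) :=
  ⟨w12.toMulEquiv, w12_goeritz⟩

end Summit.SmoothPoincare4.SmoothPoincare4.Theorems.ShadowApproximation.NilpotentGenusClass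

end
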